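import Summits.ValiantsHypothesis.ValiantsHypothesis.Theses.KPlusLogSqLaw
import Summits.ValiantsHypothesis.ValiantsHypothesis.Theorems.KPlusLogSqLawTropicalBSplitDefs
import Summits.ValiantsHypothesis.ValiantsHypothesis.Theorems.KPlusLogSqLawTropicalBSplitGlue

/-!
# Route «KPlusLogSqLaw», crux `TropicalB` (stmt-ValiantsHypothesis-19771) — SIGNS ARE WORTH AT MOST A FACTOR TWO:
# the signed row and the unsigned row agree, `TropRootLawAt m K B → TropRowD m K (2·B)`, hence `TropicalB ⟺ unsigned TropicalB`

HONEST FRAMING.  Helper file toward the registered stub `stub_tropFat` (⟺ `TropicalB`, `…TropicalBRegimeCollapse`) of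
`Cruxes/TropicalB/Lines/birth.lean` (crux `Summit.ValiantsHypothesis.ValiantsHypothesis.Theses.KPlusLogSqLaw.TropicalB`, ledger
item `stmt-ValiantsHypothesis-19771`, route `KPlusLogSqLaw`; cell `pub-symmetroid`, seat val-sym-trop-p2 (g2), 2026-08-26).  A
STRUCTURAL equivalence between two OPEN statements; nothing is asserted about `TropicalB`, `WeakLifting`, `KPlusLogSqLaw`,
`MatrixDescartes` (stmt-ValiantsHypothesis-18050) or VP ≠ VNP.

The crux counts SIGN-ALTERNATING dominant chains (`TropRootLawAt`, hypothesis `termSign ε pₖ · termSign ε pₖ₊₁ < 0`); the cell's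
engines (val-sym-trop-p1's `DesignRowD` / `TropRowD`, `…TropicalBSplitDefs`) count UNSIGNED chains (consecutive terms distinct).
`tropRootLawAt_of_tropRowD` (unsigned ⇒ signed) is in the tree.  This file proves the converse up to a factor `2`:

* `exists_signs_many_changes` — RE-SIGNING LEMMA: for every design `(d, v, ε)` and every unsigned dominant chain `p₀, …, pₙ` there is a
  sign pattern `ε'` with the SAME support as `ε` and values in `{−1, 0, 1}` under which at least `⌈n/2⌉` of the `n` steps are sign
  changes.  Proof: average over all `2^(m²K)` sign patterns `x`; for a fixed step `k`, flipping the sign of one entry of `pₖ` at a column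
  where `pₖ` and `pₖ₊₁` differ negates `termSign pₖ` and fixes `termSign pₖ₊₁` (an entry is determined by its column inside a term), so
  exactly half of the patterns change sign at step `k`; summing over `k` and exchanging the sums, some pattern has `≥ n/2` changes.
* `tropRowD_of_tropRootLawAt : TropRootLawAt m K B → TropRowD m K (2 * B)` — keep the first term of each run of constant sign: a
  sign-alternating dominant chain (dominance does not see signs) with `#changes + 1` terms, so `#changes ≤ B` and `n ≤ 2B`.
* `tropicalB_iff_unsigned : TropicalB ↔ ∃ C, ∀ m K, TropRowD m K (2 ^ (C * (K + ⌊log₂ m⌋²)))`.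

READING (located, not claimed).  The sign hypothesis of the crux carries no asymptotic information: `TropicalB` is the unsigned
Birkhoff-shadow-type count for K-slope-class parametric assignment, and every unsigned construction (refuter side) is a signed one
at half length.  [folklore] averaging over sign patterns; runs of a sign sequence.
-/

set_option linter.dupNamespace false
set_option autoImplicit false

namespace Summit.ValiantsHypothesis.ValiantsHypothesis.Theorems.KPlusLogSqLaw

open Summit.ValiantsHypothesis.ValiantsHypothesis.Theorems.LacunarySymmetroidMatrixDescartes.TropicalCensus
open Summit.ValiantsHypothesis.ValiantsHypothesis.Theorems.MatrixDescartes.Negative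
open Summit.ValiantsHypothesis.ValiantsHypothesis.Theses.KPlusLogSqLaw (TropicalB)
open Finset

section Resign

variable {m K : ℕ}

/-! ## 1. Presence and dominance do not see signs -/
/-- Two sign patterns with the same support have the same present terms (`termSign_ne_zero_iff` of `…SplitGlue`). [folklore] -/
theorem termSign_ne_zero_iff_of_support (ε ε' : Fin m → Fin m → Fin K → ℤ)
    (hsupp : ∀ a b l, ε' a b l = 0 ↔ ε a b l = 0) (q : Equiv.Perm (Fin m) × (Fin m → Fin K)) :
    termSign ε' q ≠ 0 ↔ termSign ε q ≠ 0 := by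
  rw [termSign_ne_zero_iff, termSign_ne_zero_iff]
  exact forall_congr' fun i => not_congr (hsupp _ _ _)

/-- **Dominance does not see signs**: re-signing a design without changing its support preserves every dominant term. [folklore] -/
theorem isDominant_of_support (d : Fin K → ℕ) (v ε ε' : Fin m → Fin m → Fin K → ℤ)
    (hsupp : ∀ a b l, ε' a b l = 0 ↔ ε a b l = 0) {θ : ℤ} {p : Equiv.Perm (Fin m) × (Fin m → Fin K)}
    (hp : IsDominant d v ε θ p) : IsDominant d v ε' θ p := by
  refine ⟨(termSign_ne_zero_iff_of_support ε ε' hsupp p).mpr hp.1, fun p' hne hp' => ?_⟩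
  exact hp.2 p' hne ((termSign_ne_zero_iff_of_support ε ε' hsupp p').mp hp')

/-! ## 2. The sign of a present term under a ±1 pattern, and the one-entry flip -/

/-- Under a sign pattern `ε'` whose nonzero values are `±1` read off a Boolean table `x`, a present term has sign
`sign σ · ∏ᵢ (±1)`. [folklore] -/
theorem termSign_eq_of_table (ε ε' : Fin m → Fin m → Fin K → ℤ) (x : Fin m × Fin m × Fin K → Bool)
    (hval : ∀ a b l, ε a b l ≠ 0 → ε' a b l = if x (a, b, l) then 1 else -1)
    (q : Equiv.Perm (Fin m) × (Fin m → Fin K)) (hq : termSign ε q ≠ 0) :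
    termSign ε' q = (Equiv.Perm.sign q.1 : ℤ) * ∏ i, (if x (q.1 i, i, q.2 i) then (1 : ℤ) else -1) := by
  unfold termSign
  congr 1
  refine Finset.prod_congr rfl fun i _ => ?_
  exact hval _ _ _ ((termSign_ne_zero_iff ε q).mp hq i)

/-- Flipping the table at the entry of `q` in column `b₀` negates the `±1`-product of `q`. [folklore] -/
theorem prod_table_flip_self (x : Fin m × Fin m × Fin K → Bool) (q : Equiv.Perm (Fin m) × (Fin m → Fin K)) (b₀ : Fin m) :
    (∏ i, (if Function.update x (q.1 b₀, b₀, q.2 b₀) (!x (q.1 b₀, b₀, q.2 b₀)) (q.1 i, i, q.2 i) then (1 : ℤ) else -1))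
      = -∏ i, (if x (q.1 i, i, q.2 i) then (1 : ℤ) else -1) := by
  classical
  set e₀ : Fin m × Fin m × Fin K := (q.1 b₀, b₀, q.2 b₀) with he₀
  set f : Fin m → ℤ := fun i => if x (q.1 i, i, q.2 i) then (1 : ℤ) else -1 with hf
  have hpt : (fun i => (if Function.update x e₀ (!x e₀) (q.1 i, i, q.2 i) then (1 : ℤ) else -1))
      = Function.update f b₀ (-f b₀) := by
    funext i
    by_cases hi : i = b₀
    · subst hi
      rw [Function.update_self, Function.update_self]
      simp only [hf]
      rw [← he₀]
      cases x e₀ <;> simp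
    · have hne : (q.1 i, i, q.2 i) ≠ e₀ := by
        intro h
        apply hi
        have := congrArg (fun t : Fin m × Fin m × Fin K => t.2.1) h
        simpa [he₀] using this
      rw [Function.update_of_ne hne, Function.update_of_ne hi]
  rw [hpt, Finset.prod_update_of_mem (mem_univ b₀), sdiff_singleton_eq_erase,
    ← Finset.mul_prod_erase univ f (mem_univ b₀)]
  ring

/-- Flipping the table at the entry of `q` in column `b₀` does not change the `±1`-product of a term `q'` whose entry in column
`b₀` differs from that of `q` (an entry of a term is determined by its column). [folklore] -/
theorem prod_table_flip_other (x : Fin m × Fin m × Fin K → Bool) (q q' : Equiv.Perm (Fin m) × (Fin m → Fin K)) (b₀ : Fin m)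
    (hb : (q'.1 b₀, q'.2 b₀) ≠ (q.1 b₀, q.2 b₀)) :
    (∏ i, (if Function.update x (q.1 b₀, b₀, q.2 b₀) (!x (q.1 b₀, b₀, q.2 b₀)) (q'.1 i, i, q'.2 i) then (1 : ℤ) else -1))
      = ∏ i, (if x (q'.1 i, i, q'.2 i) then (1 : ℤ) else -1) := by
  refine Finset.prod_congr rfl fun i _ => ?_
  have hne : (q'.1 i, i, q'.2 i) ≠ (q.1 b₀, b₀, q.2 b₀) := by
    intro h
    have h2 : i = b₀ := by
      have := congrArg (fun t : Fin m × Fin m × Fin K => t.2.1) h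
      simpa using this
    subst h2
    apply hb
    have h1 := congrArg (fun t : Fin m × Fin m × Fin K => t.1) h
    have h3 := congrArg (fun t : Fin m × Fin m × Fin K => t.2.2) h
    simp only at h1 h3
    rw [h1, h3]
  rw [Function.update_of_ne hne]

/-! ## 3. The re-signing lemma (averaging over all sign patterns) -/

/-- **Re-signing lemma.**  For every design and every unsigned dominant chain `p₀, …, pₙ` (consecutive terms distinct) there is a
Boolean table `x` such that, under the sign pattern `ε'(a,b,l) = 0 / +1 / −1` according to `ε(a,b,l) = 0 / x = true / x = false`,
at least half of the `n` steps are sign changes: `n ≤ 2 · #{k : termSign ε' pₖ · termSign ε' pₖ₊₁ < 0}`. [folklore] -/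
theorem exists_signs_many_changes (d : Fin K → ℕ) (v ε : Fin m → Fin m → Fin K → ℤ) {n : ℕ} (θ : Fin (n + 1) → ℤ)
    (p : Fin (n + 1) → Equiv.Perm (Fin m) × (Fin m → Fin K)) (hdom : ∀ k, IsDominant d v ε (θ k) (p k))
    (hne : ∀ k : Fin n, p k.castSucc ≠ p k.succ) :
    ∃ x : Fin m × Fin m × Fin K → Bool,
      n ≤ 2 * (univ.filter fun k : Fin n =>
        termSign (fun a b l => if ε a b l = 0 then 0 else if x (a, b, l) then 1 else -1) (p k.castSucc) *
        termSign (fun a b l => if ε a b l = 0 then 0 else if x (a, b, l) then 1 else -1) (p k.succ) < 0).card := by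
  classical
  -- notation-free abbreviations
  set E : (Fin m × Fin m × Fin K → Bool) → Fin m → Fin m → Fin K → ℤ :=
    fun x a b l => if ε a b l = 0 then 0 else if x (a, b, l) then 1 else -1 with hE
  have hsupp : ∀ x a b l, E x a b l = 0 ↔ ε a b l = 0 := by
    intro x a b l
    simp only [hE]
    by_cases h : ε a b l = 0
    · simp [h]
    · simp only [h, if_false, iff_false]
      split_ifs <;> norm_num
  have hval : ∀ x a b l, ε a b l ≠ 0 → E x a b l = if x (a, b, l) then 1 else -1 := by
    intro x a b l h
    simp only [hE, h, if_false]
  have hpres : ∀ k, termSign ε (p k) ≠ 0 := fun k => (hdom k).1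
  -- the ±1-product of a term under the table `x`
  set P : (Fin m × Fin m × Fin K → Bool) → (Equiv.Perm (Fin m) × (Fin m → Fin K)) → ℤ :=
    fun x q => ∏ i, (if x (q.1 i, i, q.2 i) then (1 : ℤ) else -1) with hP
  have hT : ∀ x k, termSign (E x) (p k) = (Equiv.Perm.sign (p k).1 : ℤ) * P x (p k) :=
    fun x k => termSign_eq_of_table ε (E x) x (hval x) (p k) (hpres k)
  have hPne : ∀ x q, P x q ≠ 0 := by
    intro x q
    simp only [hP]
    rw [Finset.prod_ne_zero_iff]
    intro i _
    split_ifs <;> norm_num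
  have hsgn : ∀ q : Equiv.Perm (Fin m) × (Fin m → Fin K), ((Equiv.Perm.sign q.1 : ℤˣ) : ℤ) ≠ 0 := fun q => Units.ne_zero _
  have hTne : ∀ x k, termSign (E x) (p k) ≠ 0 := by
    intro x k
    rw [hT]
    exact mul_ne_zero (hsgn _) (hPne _ _)
  -- the step statistic
  set step : (Fin m × Fin m × Fin K → Bool) → Fin n → ℤ :=
    fun x k => termSign (E x) (p k.castSucc) * termSign (E x) (p k.succ) with hstep
  have hstep_ne : ∀ x k, step x k ≠ 0 := fun x k => mul_ne_zero (hTne x _) (hTne x _)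
  -- for each step, a column where the two consecutive terms differ
  have hcol : ∀ k : Fin n, ∃ b₀ : Fin m,
      ((p k.succ).1 b₀, (p k.succ).2 b₀) ≠ ((p k.castSucc).1 b₀, (p k.castSucc).2 b₀) := by
    intro k
    by_contra h
    push Not at h
    apply hne k
    refine Prod.ext (Equiv.ext fun b => ?_) (funext fun b => ?_)
    · exact (congrArg Prod.fst (h b)).symm
    · exact (congrArg Prod.snd (h b)).symm
  choose col hcolspec using hcol
  -- the flip at step k
  set flip : Fin n → (Fin m × Fin m × Fin K → Bool) → (Fin m × Fin m × Fin K → Bool) :=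
    fun k x => Function.update x ((p k.castSucc).1 (col k), col k, (p k.castSucc).2 (col k))
      (!x ((p k.castSucc).1 (col k), col k, (p k.castSucc).2 (col k))) with hflip
  have hflip_step : ∀ k x, step (flip k x) k = -step x k := by
    intro k x
    simp only [hstep]
    rw [hT, hT, hT, hT]
    have h1 : P (flip k x) (p k.castSucc) = -P x (p k.castSucc) := by
      simp only [hP, hflip]
      exact prod_table_flip_self x (p k.castSucc) (col k)
    have h2 : P (flip k x) (p k.succ) = P x (p k.succ) := by
      simp only [hP, hflip]
      exact prod_table_flip_other x (p k.castSucc) (p k.succ) (col k) (hcolspec k)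
    rw [h1, h2]
    ring
  have hflip_inv : ∀ k x, flip k (flip k x) = x := by
    intro k x
    simp only [hflip]
    funext e
    by_cases he : e = ((p k.castSucc).1 (col k), col k, (p k.castSucc).2 (col k))
    · subst he
      rw [Function.update_self, Function.update_self, Bool.not_not]
    · rw [Function.update_of_ne he, Function.update_of_ne he]
  -- the set of patterns that change sign at step k has exactly half the patterns
  set X := (univ : Finset (Fin m × Fin m × Fin K → Bool)) with hX
  set C : Fin n → Finset (Fin m × Fin m × Fin K → Bool) := fun k => X.filter fun x => step x k < 0 with hC
  have hhalf : ∀ k, 2 * (C k).card = X.card := by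
    intro k
    set D := X.filter fun x => ¬ step x k < 0 with hD
    have hCD : (C k).card + D.card = X.card := by
      simp only [hC, hD]
      exact Finset.card_filter_add_card_filter_not _
    -- flip k maps C k into D and D into C k, injectively
    have hinj : ∀ k, Function.Injective (flip k) := by
      intro k a b hab
      have := congrArg (flip k) hab
      rwa [hflip_inv, hflip_inv] at this
    have h1 : (C k).card ≤ D.card := by
      refine Finset.card_le_card_of_injOn (flip k) (fun x hx => ?_) ((hinj k).injOn)
      simp only [hC, hD, Finset.mem_univ, true_and, Finset.coe_filter, Set.mem_setOf_eq, hX] at hx ⊢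
      rw [hflip_step]
      omega
    have h2 : D.card ≤ (C k).card := by
      refine Finset.card_le_card_of_injOn (flip k) (fun x hx => ?_) ((hinj k).injOn)
      simp only [hC, hD, Finset.mem_univ, true_and, Finset.coe_filter, Set.mem_setOf_eq, hX] at hx ⊢
      rw [hflip_step]
      have := hstep_ne x k
      omega
    omega
  -- double counting: Σ_k #C k = Σ_x #changes(x)
  set ch : (Fin m × Fin m × Fin K → Bool) → ℕ := fun x => (univ.filter fun k : Fin n => step x k < 0).card with hch
  have hdouble : ∑ k : Fin n, (C k).card = ∑ x ∈ X, ch x := by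
    simp only [hC, hch, Finset.card_filter, hX]
    exact Finset.sum_comm
  have hsum : ∑ x ∈ X, (2 * ch x) = ∑ x ∈ X, n := by
    rw [← Finset.mul_sum, ← hdouble, Finset.mul_sum]
    simp only [hhalf, Finset.sum_const, smul_eq_mul, Finset.card_univ, Fintype.card_fin, hX]
    ring
  have hXne : X.Nonempty := Finset.univ_nonempty
  obtain ⟨x, -, hx⟩ := Finset.exists_le_of_sum_le hXne (le_of_eq hsum.symm)
  exact ⟨x, hx⟩

/-! ## 4. Runs of a nowhere-zero sign sequence: the first elements of the runs alternate -/

/-- **Alternating subsequence.**  Let `s₀, …, sₙ` be nonzero integers and `S` the set of steps `k` with `sₖ·sₖ₊₁ < 0`.  Order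
the set `{0} ∪ {k+1 : k ∈ S}` increasingly as `g₀ < g₁ < ⋯ < g_c`; then consecutive selected signs are opposite:
`s_{gᵢ} · s_{gᵢ₊₁} < 0`. [folklore] -/
theorem runs_alternate {n : ℕ} (s : Fin (n + 1) → ℤ) (hs : ∀ j, s j ≠ 0) (S : Finset (Fin n))
    (hS : ∀ k, k ∈ S ↔ s k.castSucc * s k.succ < 0) {c : ℕ}
    (hT : (insert (0 : Fin (n + 1)) (S.map (Fin.succEmb n))).card = c + 1) (i : Fin c) :
    s ((insert (0 : Fin (n + 1)) (S.map (Fin.succEmb n))).orderEmbOfFin hT i.castSucc) *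
      s ((insert (0 : Fin (n + 1)) (S.map (Fin.succEmb n))).orderEmbOfFin hT i.succ) < 0 := by
  classical
  set T := insert (0 : Fin (n + 1)) (S.map (Fin.succEmb n)) with hTdef
  set g := T.orderEmbOfFin hT with hg
  set t := g i.castSucc with ht
  set t' := g i.succ with ht'
  have htt' : t < t' := g.strictMono Fin.castSucc_lt_succ
  have ht'T : t' ∈ T := T.orderEmbOfFin_mem hT _
  have ht'0 : t' ≠ 0 := ne_of_gt (lt_of_le_of_lt (Fin.zero_le t) htt')
  -- t' = k₀ + 1 with a sign change at k₀
  have hk₀ : ∃ k₀ ∈ S, k₀.succ = t' := by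
    rcases Finset.mem_insert.mp ht'T with h | h
    · exact absurd h ht'0
    · obtain ⟨k₀, hk₀S, hk₀⟩ := Finset.mem_map.mp h
      exact ⟨k₀, hk₀S, by simpa using hk₀⟩
  obtain ⟨k₀, hk₀S, hk₀t'⟩ := hk₀
  have hchange : s k₀.castSucc * s k₀.succ < 0 := (hS k₀).mp hk₀S
  -- no element of T strictly between t and t'
  have hgap : ∀ u ∈ T, ¬ (t < u ∧ u < t') := by
    rintro u hu ⟨h1, h2⟩
    have hu' : u ∈ Set.range g := by rw [hg, Finset.range_orderEmbOfFin]; exact hu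
    obtain ⟨j, rfl⟩ := hu'
    have h1' : i.castSucc < j := g.lt_iff_lt.mp h1
    have h2' : j < i.succ := g.lt_iff_lt.mp h2
    have h1'' : (i : ℕ) < j := h1'
    have h2'' : (j : ℕ) < i + 1 := by simpa [Fin.lt_def] using h2'
    omega
  have htk₀ : (t : ℕ) ≤ k₀ := by
    have h1 : (t : ℕ) < t' := htt'
    rw [← hk₀t'] at h1
    simpa [Fin.val_succ] using h1
  have hk₀n : (k₀ : ℕ) < n := k₀.isLt
  -- signs are constant on [t, k₀]
  have hconst : ∀ e : ℕ, ∀ he : (t : ℕ) + e ≤ k₀, 0 < s t * s ⟨t + e, by omega⟩ := by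
    intro e
    induction e with
    | zero =>
      intro he
      have : (⟨(t : ℕ) + 0, by omega⟩ : Fin (n + 1)) = t := Fin.ext (by simp)
      rw [this]
      exact mul_self_pos.mpr (hs t)
    | succ e ih =>
      intro he
      have he' : (t : ℕ) + e ≤ k₀ := by omega
      have ih' := ih he'
      -- the step j = t + e is not a sign change
      set j : Fin n := ⟨t + e, by omega⟩ with hj
      have hjc : j.castSucc = ⟨(t : ℕ) + e, by omega⟩ := Fin.ext (by simp [hj])
      have hjs : j.succ = ⟨(t : ℕ) + (e + 1), by omega⟩ := Fin.ext (by simp [hj]; omega)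
      have hjS : j ∉ S := by
        intro hjS
        have hmem : j.succ ∈ T := by
          rw [hTdef, Finset.mem_insert, Finset.mem_map]
          exact Or.inr ⟨j, hjS, by simp⟩
        refine hgap j.succ hmem ⟨?_, ?_⟩
        · rw [Fin.lt_def, hjs]; simp
        · rw [Fin.lt_def, hjs, ← hk₀t']; simp [Fin.val_succ]; omega
      have hpos : 0 < s j.castSucc * s j.succ := by
        have h1 : ¬ s j.castSucc * s j.succ < 0 := fun h => hjS ((hS j).mpr h)
        have h2 : s j.castSucc * s j.succ ≠ 0 := mul_ne_zero (hs _) (hs _)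
        omega
      rw [hjc, hjs] at hpos
      have hsq : 0 < s ⟨(t : ℕ) + e, by omega⟩ * s ⟨(t : ℕ) + e, by omega⟩ := mul_self_pos.mpr (hs _)
      have key : (s t * s ⟨(t : ℕ) + e, by omega⟩) * (s ⟨(t : ℕ) + e, by omega⟩ * s ⟨(t : ℕ) + (e + 1), by omega⟩)
          = (s t * s ⟨(t : ℕ) + (e + 1), by omega⟩) * (s ⟨(t : ℕ) + e, by omega⟩ * s ⟨(t : ℕ) + e, by omega⟩) := by ring
      have hprod := mul_pos ih' hpos
      rw [key] at hprod
      exact (mul_pos_iff_of_pos_right hsq).mp hprod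
  have hk₀c : k₀.castSucc = ⟨(t : ℕ) + (k₀ - t), by omega⟩ := Fin.ext (by simp; omega)
  have h1 : 0 < s t * s k₀.castSucc := by rw [hk₀c]; exact hconst (k₀ - t) (by omega)
  have hsq : 0 < s k₀.castSucc * s k₀.castSucc := mul_self_pos.mpr (hs _)
  have key : (s t * s k₀.castSucc) * (s k₀.castSucc * s k₀.succ) = (s t * s k₀.succ) * (s k₀.castSucc * s k₀.castSucc) := by
    ring
  have hneg : (s t * s k₀.castSucc) * (s k₀.castSucc * s k₀.succ) < 0 := mul_neg_of_pos_of_neg h1 hchange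
  rw [key] at hneg
  have : s t * s k₀.succ < 0 := neg_of_mul_neg_left hneg hsq.le
  rw [hk₀t'] at this
  exact this

/-! ## 5. Signed row ⇒ unsigned row with a factor two; `TropicalB` ⟺ unsigned `TropicalB` -/

/-- **Signs are worth at most a factor two**: `TropRootLawAt m K B → TropRowD m K (2·B)`.  Given an unsigned dominant chain of a
design `(d, v, ε)`, re-sign `ε` by `exists_signs_many_changes` (same support, values in `{−1,0,1}`, `≥ n/2` sign changes), keep the
first term of every run of constant sign (`runs_alternate`): a sign-alternating dominant chain of the re-signed design with
`#changes + 1` terms, so `#changes ≤ B` by the signed row, and `n ≤ 2·#changes ≤ 2B`. -/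
theorem tropRowD_of_tropRootLawAt {m K B : ℕ} (h : TropRootLawAt m K B) : TropRowD m K (2 * B) := by
  classical
  intro d v ε n θ p hθ hdom hne
  obtain ⟨x, hx⟩ := exists_signs_many_changes d v ε θ p hdom hne
  set ε' : Fin m → Fin m → Fin K → ℤ := fun a b l => if ε a b l = 0 then 0 else if x (a, b, l) then 1 else -1 with hε'
  have hsupp : ∀ a b l, ε' a b l = 0 ↔ ε a b l = 0 := by
    intro a b l
    simp only [hε']
    by_cases h0 : ε a b l = 0
    · simp [h0]
    · simp only [h0, if_false, iff_false]
      split_ifs <;> norm_num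
  have habs : ∀ a b l, (ε' a b l).natAbs ≤ 1 := by
    intro a b l
    simp only [hε']
    split_ifs <;> simp
  have hdom' : ∀ k, IsDominant d v ε' (θ k) (p k) := fun k => isDominant_of_support d v ε ε' hsupp (hdom k)
  set s : Fin (n + 1) → ℤ := fun j => termSign ε' (p j) with hsdef
  have hs : ∀ j, s j ≠ 0 := fun j => (hdom' j).1
  set S : Finset (Fin n) := univ.filter fun k : Fin n => s k.castSucc * s k.succ < 0 with hSdef
  have hS : ∀ k, k ∈ S ↔ s k.castSucc * s k.succ < 0 := fun k => by simp [hSdef]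
  have hxS : n ≤ 2 * S.card := by simpa [hSdef, hsdef, hε'] using hx
  set T := insert (0 : Fin (n + 1)) (S.map (Fin.succEmb n)) with hTdef
  have hT : T.card = S.card + 1 := by
    rw [hTdef, Finset.card_insert_of_notMem, Finset.card_map]
    intro h0
    obtain ⟨k, -, hk⟩ := Finset.mem_map.mp h0
    exact Fin.succ_ne_zero k hk
  set g := T.orderEmbOfFin hT with hg
  have hθ' : StrictMono fun i : Fin (S.card + 1) => θ (g i) := hθ.comp g.strictMono
  have halt' : ∀ i : Fin S.card, termSign ε' (p (g i.castSucc)) * termSign ε' (p (g i.succ)) < 0 :=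
    fun i => runs_alternate s hs S hS hT i
  have hB : S.card ≤ B := h d v ε' S.card (fun i => θ (g i)) (fun i => p (g i)) habs hθ' (fun i => hdom' (g i)) halt'
  omega

/-- **`TropicalB` ⟺ unsigned `TropicalB`.**  The crux is equivalent to the `K + log² m` law for UNSIGNED dominant chains
(consecutive terms distinct, no sign hypothesis; val-sym-trop-p1's `TropRowD`), with `C ↦ C + 1`. -/
theorem tropicalB_iff_unsigned :
    TropicalB ↔ ∃ C : ℕ, ∀ m K : ℕ, TropRowD m K (2 ^ (C * (K + Nat.log 2 m ^ 2))) := by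
  constructor
  · rintro ⟨C, hC⟩
    refine ⟨C + 1, fun m K => ?_⟩
    rcases Nat.eq_zero_or_pos K with rfl | hK
    · exact tropRowD_zero m _
    refine tropRowD_mono ?_ (tropRowD_of_tropRootLawAt (hC m K))
    have hX : 1 ≤ K + Nat.log 2 m ^ 2 := by omega
    calc 2 * 2 ^ (C * (K + Nat.log 2 m ^ 2)) = 2 ^ (C * (K + Nat.log 2 m ^ 2) + 1) := by rw [pow_succ]; ring
      _ ≤ 2 ^ ((C + 1) * (K + Nat.log 2 m ^ 2)) := Nat.pow_le_pow_right two_pos (by nlinarith)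
  · rintro ⟨C, hC⟩
    exact ⟨C, fun m K => tropRootLawAt_of_tropRowD (hC m K)⟩

end Resign

end Summit.ValiantsHypothesis.ValiantsHypothesis.Theorems.KPlusLogSqLaw
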